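import Literature.AlgebraicGeometry.Smoothening.GenericSmoothness
import Literature.AlgebraicGeometry.Smoothening.ChartCentre
import HarnessLib

/-!
# The Jacobian minor of the centre in the open chart (affine forest bookkeeping, BLR 3.4)

Topic: `Literature/AlgebraicGeometry/Smoothening` (Bosch–Lütkebohmert–Raynaud, *Néron Models*,
§3.4). In the chart `R[T₁, …, T_N, U]` of `X ∩ D(h)` (`OpenChart`), the centre of the next
dilatation is generated by `ϖ`, the lifts `g₁, …, g_r` and `hU - 1` (`chartGens`); on the columns
`(a, U)` (`chartCols`) its Jacobian minor is `h · Δ` with `Δ` the minor of `g` on `a`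
(`jacobianDet_chart`, a block triangular determinant), so it does not vanish at the points of
the chart where `Δ` does not (`GenericSmoothness.linearIndependent_tmul_D_of_det_ne_zero` then
gives the independence of the differentials required by `DefectDropPointwise`). [folklore];
no named facts (D-0026).

## References

* S. Bosch, W. Lütkebohmert, M. Raynaud, *Néron Models*, Springer 1990, §3.4 (proof of Thm. 2).
  [BLRNeronModels1990] (Not held; number only.)
-/

noncomputable section

open MvPolynomial

namespace Literature.AlgebraicGeometry.Smoothening

universe u

/-! ### The Jacobian minor of the centre in the chart -/

section ChartJacobian

variable {R : Type u} [CommRing R] {N r : ℕ} (g : Fin r → MvPolynomial (Fin N) R)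
  (a : Fin r → Fin N) (h : MvPolynomial (Fin N) R)

/-- **The Jacobian minor of the centre in the chart**: on the columns `(a, U)` the minor of
`(g₁, …, g_r, hU - 1)` is `h · Δ`, `Δ` the minor of `g` on the columns `a` (block triangular
matrix). [folklore] -/
theorem jacobianDet_chart :
    jacobianDet (chartGens g h) (chartCols a) =
      rename Fin.castSucc h * rename Fin.castSucc (jacobianDet g a) := by
  rw [jacobianDet, Matrix.det_succ_column _ (Fin.last r), Fin.sum_univ_castSucc]
  -- the terms of the old rows vanish (no `U` in `g_j`)
  have hzero : ∀ i : Fin r, (Matrix.of fun i j => pderiv (chartCols a j) (chartGens g h i))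
      (Fin.castSucc i) (Fin.last r) = 0 := fun i => by
    rw [Matrix.of_apply, chartCols_last, chartGens_castSucc, pderiv_last_rename]
  simp only [hzero, mul_zero, zero_mul, Finset.sum_const_zero, zero_add]
  -- the last entry is `h`
  have hlast : (Matrix.of fun i j => pderiv (chartCols a j) (chartGens g h i))
      (Fin.last r) (Fin.last r) = rename Fin.castSucc h := by
    rw [Matrix.of_apply, chartCols_last, chartGens_last, map_sub, Derivation.map_one_eq_zero,
      sub_zero, Derivation.leibniz, pderiv_last_rename, smul_zero, add_zero, pderiv_X_self, smul_eq_mul,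
      mul_one]
  rw [hlast]
  -- the complementary submatrix is the old Jacobian matrix, renamed
  have hsub : (Matrix.of fun i j => pderiv (chartCols a j) (chartGens g h i)).submatrix
      (Fin.last r).succAbove (Fin.last r).succAbove =
        (Matrix.of fun i j => pderiv (a j) (g i)).map (rename Fin.castSucc) := by
    ext i j
    simp only [Matrix.submatrix_apply, Fin.succAbove_last, Matrix.of_apply, chartCols_castSucc,
      chartGens_castSucc, Matrix.map_apply, pderiv_rename (Fin.castSucc_injective N)]
  rw [hsub, ← AlgHom.coe_toRingHom, ← RingHom.mapMatrix_apply, ← RingHom.map_det]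
  -- the sign
  have hsign : ((-1 : MvPolynomial (Fin (N + 1)) R) ^ ((Fin.last r : ℕ) + (Fin.last r : ℕ))) = 1 := by
    rw [← two_mul, pow_mul, neg_one_sq, one_pow]
  rw [hsign, one_mul]

end ChartJacobian

end Literature.AlgebraicGeometry.Smoothening

end
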